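import Literature.AlgebraicGeometry.Motives.AbelianVarietyTateModuleTraceDimensionFormula
import Literature.AlgebraicGeometry.Motives.AbelianVarietyTateModuleFaithful
import HarnessLib

/-!
# Dimension inequalities for the Kani–Rosen factors `B_H = Im N_H` from the invariant lattices `(T_ℓ X)^H`:
# `H ≤ M ⟹ dim B_M ≤ dim B_H`, `dim B_{H₁} + dim B_{H₂} ≤ dim X + dim B_{⟨H₁, H₂⟩}` (Reyes-Carocca–Rodríguez),
# and `dim B_H = dim X ⟺ H acts trivially`

For an abelian variety `X` over a field `K` with an action `ρ : G → End X` of a group and finite subgroups `H ≤ G`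
with norm elements `N_H = Σ_{h ∈ H} ρ(h)` and factors `B_H := Im N_H` (`= ε_H(X)`, the Kani–Rosen / group-algebra
factor; for `X = J_C`, `G ≤ Aut C`: `B_H ∼ J_{C/H}` — not asserted here), the lattice additive functor lemma of the
prequel (`Motives/AbelianVarietyTateModuleTraceDimensionFormula` §4: `rk_{ℤ_ℓ} (T_ℓ X)^H = 2 dim B_H` for any prime
`ℓ` invertible in `K`, the invariants being the submodule `(T_ℓ X)^H = ⋂_{h ∈ H} {x | T_ℓ ρ(h) x = x}`) turns the
elementary lattice algebra of invariants,

* `H ≤ M ⟹ (T_ℓ X)^M ⊆ (T_ℓ X)^H`                                            (`iInf_eqLocus_tateModuleMap_antitone`),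
* `(T_ℓ X)^{H₁ ⊔ H₂} = (T_ℓ X)^{H₁} ∩ (T_ℓ X)^{H₂}`                            (`iInf_eqLocus_tateModuleMap_sup`),
* `rk(V₁ + V₂) + rk(V₁ ∩ V₂) = rk V₁ + rk V₂` for sublattices of `T_ℓ X`       (rank–nullity over the domain `ℤ_ℓ`),

into statements about dimensions which mention no `ℓ` (a prime `ℓ ∈ {2, 3}` invertible in `K` is chosen inside the
proofs, `exists_prime_natCast_ne_zero`):

* **monotonicity** `H ≤ M ⟹ dim B_M ≤ dim B_H` over ANY field (`dim_image_norm_antitone`; `dim B_G ≤ dim B_H`);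
* **Reyes-Carocca–Rodríguez's excess inequality** `dim B_{H₁} + dim B_{H₂} ≤ dim X + dim B_M` for every finite
  `M ≤ H₁ ⊔ H₂` — the dimension shadow of "`J_C × J_{C_{⟨H₁,H₂⟩}} ∼ J_{C_{H₁}} × J_{C_{H₂}} × P` for some abelian
  subvariety `P`" proved there from "`V_l^{H_1} ∩ V_l^{H_2} = V_l^{⟨H_1, H_2⟩}`" and "the dimension formula for the
  sum of two vector subspaces" (`dim_image_norm_add_dim_image_norm_le_dim_add`), together with its refinement through
  any finite `L ≤ H₁ ⊓ H₂`: `dim B_{H₁} + dim B_{H₂} ≤ dim B_L + dim B_M` (`dim_image_norm_add_dim_image_norm_le`);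
* **the trivial-action criterion** `dim B_H = dim X ⟺ ρ(h) = 1 for all h ∈ H` (`dim_image_norm_eq_dim_iff`): `⟹` because
  an abelian subvariety of full dimension is everything (`dim_lt_of_isClosedImmersion_of_not_surjective`) and `H` fixes
  `B_H` pointwise (`imageι_norm_comp_asHom`), `⟸` by the `ℓ`-adic trace formula `Tr(T_ℓ N_H) = |H| · 2 dim B_H`.

## Main statements (sorry-free; theorems only, no new definitions)

* §1 lattice algebra at a fixed prime `ℓ`: `mem_iInf_eqLocus_tateModuleMap_iff`, `iInf_eqLocus_tateModuleMap_antitone`,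
  `iInf_eqLocus_tateModuleMap_sup`, `iInf_eqLocus_tateModuleMap_sup_le_of_le_inf` and the rank identities
  `finrank_iInf_eqLocus_tateModuleMap_le_of_le`, `finrank_iInf_eqLocus_add_finrank_iInf_eqLocus_le`.
* §2 dimensions (no `ℓ` in the statements): **`dim_image_norm_antitone`**, `dim_image_normG_le_dim_image_norm`,
  **`dim_image_norm_add_dim_image_norm_le`**, **`dim_image_norm_add_dim_image_norm_le_dim_add`**,
  `dim_image_norm_add_dim_image_norm_le_dim_add_normG` (`H₁ ⊔ H₂ = G`), **`dim_image_norm_eq_dim_iff`**,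
  `dim_image_normG_eq_dim_iff`.
* §3 (v2, same seat, ADD-ONLY) the extreme cases through the lattice: `iInf_eqLocus_tateModuleMap_eq_top_iff`
  (`(T_ℓ X)^H = T_ℓ X ⟺ ρ|_H = 1`, faithfulness of `T_ℓ`), `iInf_eqLocus_tateModuleMap_eq_top_iff_dim_eq`,
  `iInf_eqLocus_tateModuleMap_eq_bot_iff_dim_eq_zero` (`(T_ℓ X)^H = 0 ⟺ dim B_H = 0`).

Relation to the tree (stated, not hidden).  Over a PERFECT field the monotonicity `dim ε_M(X) ≤ dim ε_H(X)` is
`dim_image_norm_le_of_le` / `dim_image_normG_le` of `Motives/AbelianVarietyTwoSubgroupsIdempotentRelations` (from the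
isogeny `ε_H(X) ∼ ε_M(X) × Im(N_H(|M| − N_M))`), and Proposition 1 is there in Hom-count form for every field
(`finrank_hom_image_norm_add_le`, with an enumeration `Fintype ↥(H₁ ⊔ H₂)`) and in `Motives/AbelianVarietyAdmissibleCollections`
as the isogeny `X × ε_{⟨H₁,H₂⟩}(X) ∼ ε_{H₁}(X) × ε_{H₂}(X) × P` (perfect field).  NEW here: the `ℓ`-adic invariant-lattice
lemmas of §1 (consumed by Galois-representation arguments), the dimension statements over an ARBITRARY field with no
enumeration of `⟨H₁, H₂⟩` (any finite `M ≤ H₁ ⊔ H₂`, refined through any finite `L ≤ H₁ ⊓ H₂`), and the trivial-action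
criterion `dim B_H = dim X ⟺ ρ|_H = 1`.

Scope (stated, not hidden).  `B_H = Im N_H` for the given `ρ` (no quotient curves, no Prym identification of the
excess `P`); the subgroups carry `Fintype` instances and enter only through their norm elements; `G` itself need not
be finite except where `N_G` occurs.

## References

* [ReyesCaroccaRodriguez2019] S. Reyes-Carocca, R. E. Rodríguez, *A generalisation of Kani–Rosen decomposition theorem
  for Jacobian varieties*, Ann. Sc. Norm. Super. Pisa 19 (2019), §1 Prop. 1 and §3.3 (its proof).
* [DokchitserEtAl2022] V. Dokchitser, H. Green, A. Konstantinou, A. Morgan, *Parity of ranks of Jacobians of curves*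
  (2022), §3 (additive functor lemma).
* [LangeRodriguez2022] H. Lange, R. E. Rodríguez, *Decomposition of Jacobians by Prym Varieties*, LNM 2310 (2022),
  §3.5.2 Prop. 3.5.7 (PDF p. 69) and Cor. 3.5.9 (ii) (PDF p. 70: "A_N^j ⊂ A_H^j").
* [KaniRosen1989] E. Kani, M. Rosen, *Idempotent relations and factors of Jacobians*, Math. Ann. 284 (1989), Thm. B.
* [Milne1986AbelianVarieties] J. S. Milne, *Abelian varieties* (1986), §12 Lemma 12.2 and Prop. 12.9.
-/

noncomputable section

open CategoryTheory CategoryTheory.Limits AlgebraicGeometry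
open Literature.NumberTheory.DiophantineGeometry

universe u

namespace Literature.AlgebraicGeometry.Motives

namespace AbelianVariety

variable {K : Type u} [Field K] {X : AbelianVariety K} {G : Type} [Group G]

/-! ## §1 Lattice algebra of the invariants `(T_ℓ X)^H = ⨅_{h ∈ H} eqLocus(T_ℓ ρ(h), id)` -/

section Lattice

variable (ℓ : ℕ) [Fact ℓ.Prime] (ρ : G →* End X)

/-- Membership in the invariants: `x ∈ (T_ℓ X)^H ⟺ T_ℓ ρ(h) x = x` for all `h ∈ H`.
[cite: DokchitserEtAl2022, §3 (additive functor lemma, `F(J_X)^H`)] -/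
theorem mem_iInf_eqLocus_tateModuleMap_iff (H : Subgroup G) (x : X.tateModule ℓ) :
    x ∈ (⨅ h : H, LinearMap.eqLocus (tateModuleMap ℓ (End.asHom (ρ h))) LinearMap.id) ↔
      ∀ h : H, tateModuleMap ℓ (End.asHom (ρ h)) x = x := by
  rw [Submodule.mem_iInf]
  exact forall_congr' fun h ↦ LinearMap.mem_eqLocus

/-- The stabiliser of a vector is a subgroup: for `x ∈ T_ℓ X` there is a subgroup `S ≤ G` with
`g ∈ S ⟺ T_ℓ ρ(g) x = x` (`g ↦ T_ℓ ρ(g)` is multiplicative, `T_ℓ ρ(1) = id`). [cite: MumfordAV1970, §19 Thm. 3 (p. 176)] -/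
theorem exists_subgroup_mem_iff_tateModuleMap_apply_eq (x : X.tateModule ℓ) :
    ∃ S : Subgroup G, ∀ g, g ∈ S ↔ tateModuleMap ℓ (End.asHom (ρ g)) x = x := by
  have hmul : ∀ a b : G, tateModuleMap ℓ (End.asHom (ρ (a * b))) =
      tateModuleMap ℓ (End.asHom (ρ a)) ∘ₗ tateModuleMap ℓ (End.asHom (ρ b)) := fun a b ↦ by
    rw [map_mul, ← tateModuleMap_comp]
    rfl
  have hone : tateModuleMap ℓ (End.asHom (ρ 1)) = LinearMap.id := by
    rw [map_one, ← tateModuleMap_id ℓ X]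
    rfl
  refine ⟨{ carrier := {g | tateModuleMap ℓ (End.asHom (ρ g)) x = x}
            mul_mem' := fun {a b} ha hb ↦ ?_
            one_mem' := ?_
            inv_mem' := fun {a} ha ↦ ?_ }, fun g ↦ Iff.rfl⟩
  · change tateModuleMap ℓ (End.asHom (ρ (a * b))) x = x
    change tateModuleMap ℓ (End.asHom (ρ a)) x = x at ha
    change tateModuleMap ℓ (End.asHom (ρ b)) x = x at hb
    rw [hmul, LinearMap.comp_apply, hb, ha]
  · change tateModuleMap ℓ (End.asHom (ρ 1)) x = x
    rw [hone, LinearMap.id_apply]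
  · change tateModuleMap ℓ (End.asHom (ρ a⁻¹)) x = x
    change tateModuleMap ℓ (End.asHom (ρ a)) x = x at ha
    have key : (tateModuleMap ℓ (End.asHom (ρ a⁻¹)) ∘ₗ tateModuleMap ℓ (End.asHom (ρ a))) x = x := by
      rw [← hmul, inv_mul_cancel, hone, LinearMap.id_apply]
    rwa [LinearMap.comp_apply, ha] at key

/-- `x ∈ (T_ℓ X)^H ⟺ H ≤ Stab(x)`. [cite: DokchitserEtAl2022, §3 (additive functor lemma, `F(J_X)^H`)] -/
theorem mem_iInf_eqLocus_tateModuleMap_iff_le {x : X.tateModule ℓ} {S : Subgroup G}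
    (hS : ∀ g, g ∈ S ↔ tateModuleMap ℓ (End.asHom (ρ g)) x = x) (H : Subgroup G) :
    x ∈ (⨅ h : H, LinearMap.eqLocus (tateModuleMap ℓ (End.asHom (ρ h))) LinearMap.id) ↔ H ≤ S := by
  rw [mem_iInf_eqLocus_tateModuleMap_iff]
  exact ⟨fun h g hg ↦ (hS g).2 (h ⟨g, hg⟩), fun h g ↦ (hS g).1 (h g.2)⟩

/-- **The invariants are antitone in the subgroup**: `H ≤ M ⟹ (T_ℓ X)^M ⊆ (T_ℓ X)^H`.
[cite: ReyesCaroccaRodriguez2019, §3.3 (proof of Prop. 1)] [cite: LangeRodriguez2022, §3.5.2 Prop. 3.5.7 (PDF p. 69)] -/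
theorem iInf_eqLocus_tateModuleMap_antitone {H M : Subgroup G} (hHM : H ≤ M) :
    (⨅ m : M, LinearMap.eqLocus (tateModuleMap ℓ (End.asHom (ρ m))) LinearMap.id) ≤
      ⨅ h : H, LinearMap.eqLocus (tateModuleMap ℓ (End.asHom (ρ h))) LinearMap.id := fun x hx ↦
  (mem_iInf_eqLocus_tateModuleMap_iff ℓ ρ H x).2 fun h ↦
    (mem_iInf_eqLocus_tateModuleMap_iff ℓ ρ M x).1 hx ⟨h, hHM h.2⟩

/-- **Invariants of a join are the intersection of the invariants**: `(T_ℓ X)^{H₁ ⊔ H₂} = (T_ℓ X)^{H₁} ∩ (T_ℓ X)^{H₂}`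
("`V_l^{H_1} ∩ V_l^{H_2} = V_l^{⟨H_1, H_2⟩}`": a vector fixed by `H₁` and by `H₂` has a stabiliser containing
`⟨H₁, H₂⟩`). [cite: ReyesCaroccaRodriguez2019, §3.3 (proof of Prop. 1: `V_l^{H_1} ∩ V_l^{H_2} = V_l^{⟨H_1,H_2⟩}`)] -/
theorem iInf_eqLocus_tateModuleMap_sup (H₁ H₂ : Subgroup G) :
    (⨅ h : (H₁ ⊔ H₂ : Subgroup G), LinearMap.eqLocus (tateModuleMap ℓ (End.asHom (ρ h))) LinearMap.id) =
      (⨅ h : H₁, LinearMap.eqLocus (tateModuleMap ℓ (End.asHom (ρ h))) LinearMap.id) ⊓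
        ⨅ h : H₂, LinearMap.eqLocus (tateModuleMap ℓ (End.asHom (ρ h))) LinearMap.id := by
  ext x
  obtain ⟨S, hS⟩ := exists_subgroup_mem_iff_tateModuleMap_apply_eq ℓ ρ x
  rw [Submodule.mem_inf, mem_iInf_eqLocus_tateModuleMap_iff_le ℓ ρ hS, mem_iInf_eqLocus_tateModuleMap_iff_le ℓ ρ hS,
    mem_iInf_eqLocus_tateModuleMap_iff_le ℓ ρ hS, sup_le_iff]

/-- `(T_ℓ X)^{H₁} + (T_ℓ X)^{H₂} ⊆ (T_ℓ X)^L` for `L ≤ H₁ ⊓ H₂`, and `(T_ℓ X)^{H₁} ∩ (T_ℓ X)^{H₂} ⊆ (T_ℓ X)^M` for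
`M ≤ H₁ ⊔ H₂`. [cite: ReyesCaroccaRodriguez2019, §3.3 (proof of Prop. 1)] -/
theorem iInf_eqLocus_tateModuleMap_sup_le_of_le_inf {H₁ H₂ L M : Subgroup G} (hL : L ≤ H₁ ⊓ H₂) (hM : M ≤ H₁ ⊔ H₂) :
    (⨅ h : H₁, LinearMap.eqLocus (tateModuleMap ℓ (End.asHom (ρ h))) LinearMap.id) ⊔
        (⨅ h : H₂, LinearMap.eqLocus (tateModuleMap ℓ (End.asHom (ρ h))) LinearMap.id) ≤
      (⨅ h : L, LinearMap.eqLocus (tateModuleMap ℓ (End.asHom (ρ h))) LinearMap.id) ∧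
    (⨅ h : H₁, LinearMap.eqLocus (tateModuleMap ℓ (End.asHom (ρ h))) LinearMap.id) ⊓
        (⨅ h : H₂, LinearMap.eqLocus (tateModuleMap ℓ (End.asHom (ρ h))) LinearMap.id) ≤
      ⨅ h : M, LinearMap.eqLocus (tateModuleMap ℓ (End.asHom (ρ h))) LinearMap.id := by
  refine ⟨sup_le (iInf_eqLocus_tateModuleMap_antitone ℓ ρ (hL.trans inf_le_left))
    (iInf_eqLocus_tateModuleMap_antitone ℓ ρ (hL.trans inf_le_right)), ?_⟩
  rw [← iInf_eqLocus_tateModuleMap_sup]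
  exact iInf_eqLocus_tateModuleMap_antitone ℓ ρ hM

/-- Rank–nullity for two sublattices of a finitely generated `ℤ_ℓ`-module: `rk(s + t) + rk(s ∩ t) = rk s + rk t`
("the dimension formula for the sum of two vector subspaces", over the domain `ℤ_ℓ`). [cite: ReyesCaroccaRodriguez2019, §3.3 (proof of Prop. 1)] -/
theorem finrank_sup_add_finrank_inf_eq_padicInt {M : Type*} [AddCommGroup M] [Module ℤ_[ℓ] M] [Module.Finite ℤ_[ℓ] M]
    (s t : Submodule ℤ_[ℓ] M) :
    Module.finrank ℤ_[ℓ] ↥(s ⊔ t) + Module.finrank ℤ_[ℓ] ↥(s ⊓ t) = Module.finrank ℤ_[ℓ] s + Module.finrank ℤ_[ℓ] t := by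
  have h := Submodule.rank_sup_add_rank_inf_eq s t
  rw [← Module.finrank_eq_rank, ← Module.finrank_eq_rank, ← Module.finrank_eq_rank, ← Module.finrank_eq_rank] at h
  exact_mod_cast h

variable {H M H₁ H₂ L : Subgroup G}

/-- **`H ≤ M ⟹ rk (T_ℓ X)^M ≤ rk (T_ℓ X)^H`** (for `T_ℓ X` finitely generated).
[cite: ReyesCaroccaRodriguez2019, §3.3 (proof of Prop. 1)] [cite: LangeRodriguez2022, §3.5.2 Prop. 3.5.7 (PDF p. 69)] -/
theorem finrank_iInf_eqLocus_tateModuleMap_le_of_le [Module.Finite ℤ_[ℓ] (X.tateModule ℓ)] (hHM : H ≤ M) :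
    Module.finrank ℤ_[ℓ] ↥(⨅ m : M, LinearMap.eqLocus (tateModuleMap ℓ (End.asHom (ρ m))) LinearMap.id) ≤
      Module.finrank ℤ_[ℓ] ↥(⨅ h : H, LinearMap.eqLocus (tateModuleMap ℓ (End.asHom (ρ h))) LinearMap.id) :=
  Submodule.finrank_mono (iInf_eqLocus_tateModuleMap_antitone ℓ ρ hHM)

/-- **The rank form of the excess inequality**: for `L ≤ H₁ ⊓ H₂` and `M ≤ H₁ ⊔ H₂`,
`rk (T_ℓ X)^{H₁} + rk (T_ℓ X)^{H₂} ≤ rk (T_ℓ X)^L + rk (T_ℓ X)^M` — from `rk(V₁ + V₂) + rk(V₁ ∩ V₂) = rk V₁ + rk V₂`,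
`V₁ + V₂ ⊆ V^L` and `V₁ ∩ V₂ = V^{H₁ ⊔ H₂} ⊆ V^M`. [cite: ReyesCaroccaRodriguez2019, §3.3 (proof of Prop. 1)] -/
theorem finrank_iInf_eqLocus_add_finrank_iInf_eqLocus_le [Module.Finite ℤ_[ℓ] (X.tateModule ℓ)] (hL : L ≤ H₁ ⊓ H₂)
    (hM : M ≤ H₁ ⊔ H₂) :
    Module.finrank ℤ_[ℓ] ↥(⨅ h : H₁, LinearMap.eqLocus (tateModuleMap ℓ (End.asHom (ρ h))) LinearMap.id) +
        Module.finrank ℤ_[ℓ] ↥(⨅ h : H₂, LinearMap.eqLocus (tateModuleMap ℓ (End.asHom (ρ h))) LinearMap.id) ≤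
      Module.finrank ℤ_[ℓ] ↥(⨅ h : L, LinearMap.eqLocus (tateModuleMap ℓ (End.asHom (ρ h))) LinearMap.id) +
        Module.finrank ℤ_[ℓ] ↥(⨅ h : M, LinearMap.eqLocus (tateModuleMap ℓ (End.asHom (ρ h))) LinearMap.id) := by
  obtain ⟨h1, h2⟩ := iInf_eqLocus_tateModuleMap_sup_le_of_le_inf ℓ ρ hL hM
  rw [← finrank_sup_add_finrank_inf_eq_padicInt ℓ]
  exact Nat.add_le_add (Submodule.finrank_mono h1) (Submodule.finrank_mono h2)

/-- The same with `V` itself in place of `V^L`: `rk (T_ℓ X)^{H₁} + rk (T_ℓ X)^{H₂} ≤ rk T_ℓ X + rk (T_ℓ X)^M` for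
`M ≤ H₁ ⊔ H₂` ("`dim(V_l^{H_1} + V_l^{H_2}) + δ_l = dim V_l`"). [cite: ReyesCaroccaRodriguez2019, §3.3 (proof of Prop. 1)] -/
theorem finrank_iInf_eqLocus_add_finrank_iInf_eqLocus_le_finrank_add [Module.Finite ℤ_[ℓ] (X.tateModule ℓ)]
    (hM : M ≤ H₁ ⊔ H₂) :
    Module.finrank ℤ_[ℓ] ↥(⨅ h : H₁, LinearMap.eqLocus (tateModuleMap ℓ (End.asHom (ρ h))) LinearMap.id) +
        Module.finrank ℤ_[ℓ] ↥(⨅ h : H₂, LinearMap.eqLocus (tateModuleMap ℓ (End.asHom (ρ h))) LinearMap.id) ≤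
      Module.finrank ℤ_[ℓ] (X.tateModule ℓ) +
        Module.finrank ℤ_[ℓ] ↥(⨅ h : M, LinearMap.eqLocus (tateModuleMap ℓ (End.asHom (ρ h))) LinearMap.id) := by
  have h2 : (⨅ h : H₁, LinearMap.eqLocus (tateModuleMap ℓ (End.asHom (ρ h))) LinearMap.id) ⊓
      (⨅ h : H₂, LinearMap.eqLocus (tateModuleMap ℓ (End.asHom (ρ h))) LinearMap.id) ≤
      ⨅ h : M, LinearMap.eqLocus (tateModuleMap ℓ (End.asHom (ρ h))) LinearMap.id := by
    rw [← iInf_eqLocus_tateModuleMap_sup]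
    exact iInf_eqLocus_tateModuleMap_antitone ℓ ρ hM
  rw [← finrank_sup_add_finrank_inf_eq_padicInt ℓ]
  exact Nat.add_le_add (Submodule.finrank_le _) (Submodule.finrank_mono h2)

end Lattice

/-! ## §2 Dimension inequalities for `B_H = Im N_H` (no `ℓ` in the statements) -/

section Dimension

variable (ρ : G →* End X) {H M H₁ H₂ L : Subgroup G} [Fintype H] [Fintype M] [Fintype H₁] [Fintype H₂]
  [Fintype L] {N NM N₁ N₂ NL NG : X ⟶ X}

/-- **Monotonicity of the Kani–Rosen factors: `H ≤ M ⟹ dim B_M ≤ dim B_H`** (`B_H = Im N_H`; for Jacobians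
`J_{C/M} → J_{C/H}` has finite kernel).  Proof: `2 dim B_M = rk (T_ℓ X)^M ≤ rk (T_ℓ X)^H = 2 dim B_H` for a prime `ℓ`
invertible in `K` — over ANY field (the tree's `dim_image_norm_le_of_le` is the perfect-field isogeny form).
[cite: LangeRodriguez2022, §3.5.2 Prop. 3.5.7 and Cor. 3.5.9 (ii) (PDF pp. 69–70)]
[cite: ReyesCaroccaRodriguez2019, §3.3 (proof of Prop. 1)] [cite: DokchitserEtAl2022, §3 (additive functor lemma)] -/
theorem dim_image_norm_antitone (hN : End.of N = ∑ h : H, ρ h) (hNM : End.of NM = ∑ m : M, ρ m) (hHM : H ≤ M) :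
    (image NM).dim ≤ (image N).dim := by
  obtain ⟨ℓ, hℓp, hℓ⟩ := AbelianVariety.exists_prime_natCast_ne_zero K
  haveI : Fact ℓ.Prime := ⟨hℓp⟩
  haveI := module_finite_tateModule_of_cast_ne_zero X ℓ hℓ
  have h := finrank_iInf_eqLocus_tateModuleMap_le_of_le ℓ ρ hHM
  rw [finrank_iInf_eqLocus_tateModuleMap_eq_two_mul_dim ℓ ρ hN hℓ,
    finrank_iInf_eqLocus_tateModuleMap_eq_two_mul_dim ℓ ρ hNM hℓ] at h
  omega

/-- `dim B_G ≤ dim B_H` for every finite subgroup `H` of a finite group `G`, over any field (perfect-field isogeny form: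
the tree's `dim_image_normG_le`). [cite: LangeRodriguez2022, §3.5.2 Prop. 3.5.7 and Cor. 3.5.9 (ii) (PDF pp. 69–70)]
[cite: KaniRosen1989, Thm. B] -/
theorem dim_image_normG_le_dim_image_norm [Fintype G] (hN : End.of N = ∑ h : H, ρ h) (hNG : End.of NG = ∑ g, ρ g) :
    (image NG).dim ≤ (image N).dim := by
  haveI : Fintype (⊤ : Subgroup G) := Fintype.ofFinite _
  have hNG' : End.of NG = ∑ g : (⊤ : Subgroup G), ρ g := by
    rw [hNG]
    exact Fintype.sum_equiv Subgroup.topEquiv.symm.toEquiv _ _ fun _ ↦ rfl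
  exact dim_image_norm_antitone ρ hN hNG' le_top

/-- **The refined excess inequality: `dim B_{H₁} + dim B_{H₂} ≤ dim B_L + dim B_M`** for finite subgroups with
`L ≤ H₁ ⊓ H₂` and `M ≤ H₁ ⊔ H₂` (sharpest with `L = H₁ ⊓ H₂`, `M = ⟨H₁, H₂⟩`): the rank inequality
`rk V^{H₁} + rk V^{H₂} ≤ rk V^L + rk V^M` for `V = T_ℓ X` divided by `2`. [cite: ReyesCaroccaRodriguez2019, §1 Prop. 1 and §3.3]
[cite: DokchitserEtAl2022, §3 (additive functor lemma)] -/
theorem dim_image_norm_add_dim_image_norm_le (hN₁ : End.of N₁ = ∑ h : H₁, ρ h) (hN₂ : End.of N₂ = ∑ h : H₂, ρ h)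
    (hNL : End.of NL = ∑ h : L, ρ h) (hNM : End.of NM = ∑ m : M, ρ m) (hL : L ≤ H₁ ⊓ H₂) (hM : M ≤ H₁ ⊔ H₂) :
    (image N₁).dim + (image N₂).dim ≤ (image NL).dim + (image NM).dim := by
  obtain ⟨ℓ, hℓp, hℓ⟩ := AbelianVariety.exists_prime_natCast_ne_zero K
  haveI : Fact ℓ.Prime := ⟨hℓp⟩
  haveI := module_finite_tateModule_of_cast_ne_zero X ℓ hℓ
  have h := finrank_iInf_eqLocus_add_finrank_iInf_eqLocus_le ℓ ρ hL hM
  rw [finrank_iInf_eqLocus_tateModuleMap_eq_two_mul_dim ℓ ρ hN₁ hℓ,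
    finrank_iInf_eqLocus_tateModuleMap_eq_two_mul_dim ℓ ρ hN₂ hℓ,
    finrank_iInf_eqLocus_tateModuleMap_eq_two_mul_dim ℓ ρ hNL hℓ,
    finrank_iInf_eqLocus_tateModuleMap_eq_two_mul_dim ℓ ρ hNM hℓ] at h
  omega

/-- **Reyes-Carocca–Rodríguez's excess inequality: `dim B_{H₁} + dim B_{H₂} ≤ dim X + dim B_M`** for every finite
`M ≤ ⟨H₁, H₂⟩` (in particular `M = ⟨H₁, H₂⟩`): the dimension shadow of
"`J_C × J_{C_{⟨H_1,H_2⟩}} ∼ J_{C_{H_1}} × J_{C_{H_2}} × P` for some abelian subvariety `P` of `J_C`" ("part of such an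
excess can be geometrically identified"), here for `B_H = Im N_H` on any abelian variety with a `G`-action over any
field. [cite: ReyesCaroccaRodriguez2019, §1 Prop. 1 and §3.3 (proof)] [cite: DokchitserEtAl2022, §3 (additive functor lemma)] -/
theorem dim_image_norm_add_dim_image_norm_le_dim_add (hN₁ : End.of N₁ = ∑ h : H₁, ρ h)
    (hN₂ : End.of N₂ = ∑ h : H₂, ρ h) (hNM : End.of NM = ∑ m : M, ρ m) (hM : M ≤ H₁ ⊔ H₂) :
    (image N₁).dim + (image N₂).dim ≤ X.dim + (image NM).dim := by
  obtain ⟨ℓ, hℓp, hℓ⟩ := AbelianVariety.exists_prime_natCast_ne_zero K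
  haveI : Fact ℓ.Prime := ⟨hℓp⟩
  haveI := module_finite_tateModule_of_cast_ne_zero X ℓ hℓ
  have h := finrank_iInf_eqLocus_add_finrank_iInf_eqLocus_le_finrank_add ℓ ρ (H₁ := H₁) (H₂ := H₂) hM
  rw [finrank_iInf_eqLocus_tateModuleMap_eq_two_mul_dim ℓ ρ hN₁ hℓ,
    finrank_iInf_eqLocus_tateModuleMap_eq_two_mul_dim ℓ ρ hN₂ hℓ,
    finrank_iInf_eqLocus_tateModuleMap_eq_two_mul_dim ℓ ρ hNM hℓ, X.finrank_tateModule_eq_two_mul_dim ℓ hℓ] at h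
  omega

/-- The case `⟨H₁, H₂⟩ = G` (finite): `dim B_{H₁} + dim B_{H₂} ≤ dim X + dim B_G` ("if the genus of `C_{⟨H_1,H_2⟩}` is
zero and `g_C = g_{C_{H_1}} + g_{C_{H_2}}` then `J_C ∼ J_{C_{H_1}} × J_{C_{H_2}}`" is the extremal case).
[cite: ReyesCaroccaRodriguez2019, §1 Prop. 1 and §3.3 (proof)] -/
theorem dim_image_norm_add_dim_image_norm_le_dim_add_normG [Fintype G] (hN₁ : End.of N₁ = ∑ h : H₁, ρ h)
    (hN₂ : End.of N₂ = ∑ h : H₂, ρ h) (hNG : End.of NG = ∑ g, ρ g) (hG : H₁ ⊔ H₂ = ⊤) :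
    (image N₁).dim + (image N₂).dim ≤ X.dim + (image NG).dim := by
  haveI : Fintype (⊤ : Subgroup G) := Fintype.ofFinite _
  have hNG' : End.of NG = ∑ g : (⊤ : Subgroup G), ρ g := by
    rw [hNG]
    exact Fintype.sum_equiv Subgroup.topEquiv.symm.toEquiv _ _ fun _ ↦ rfl
  exact dim_image_norm_add_dim_image_norm_le_dim_add ρ hN₁ hN₂ hNG' hG.ge

/-- **`dim B_H = dim X ⟺ H acts trivially`** (`B_H = Im N_H`): if `dim Im N_H = dim X` the closed immersion
`ι_H : B_H ↪ X` is surjective (a proper abelian subvariety has smaller dimension), and `H` fixes `B_H` pointwise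
(`ι_H ≫ ρ(h) = ι_H`), so `ρ(h) = 1`; conversely for the trivial action `N_H = |H| · 1_X` and
`Tr(T_ℓ N_H) = |H| · 2 dim B_H = |H| · 2 dim X`. [cite: LangeRodriguez2022, §3.5.2 Prop. 3.5.7 (PDF p. 69)]
[cite: Milne1986AbelianVarieties, §12 Prop. 12.9 (PDF p. 192)] [cite: DokchitserEtAl2022, §3 (additive functor lemma)] -/
theorem dim_image_norm_eq_dim_iff (hN : End.of N = ∑ h : H, ρ h) : (image N).dim = X.dim ↔ ∀ h : H, ρ h = 1 := by
  constructor
  · intro hdim h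
    have hsurj : Function.Surjective (Hom.toSchemeHom (imageι N)) := by
      by_contra hns
      exact absurd hdim (dim_lt_of_isClosedImmersion_of_not_surjective (imageι N) hns).ne
    haveI : Surjective (Hom.toSchemeHom (imageι N)) := ⟨hsurj⟩
    haveI := epi_of_surjective_toSchemeHom (imageι N)
    have key : imageι N ≫ End.asHom (ρ h) = imageι N ≫ 𝟙 X := by
      rw [imageι_norm_comp_asHom ρ hN h, Category.comp_id]
    exact (cancel_epi (imageι N)).1 key
  · intro hρ
    obtain ⟨ℓ, hℓp, hℓ⟩ := AbelianVariety.exists_prime_natCast_ne_zero K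
    haveI : Fact ℓ.Prime := ⟨hℓp⟩
    have hN' : N = ((Fintype.card H : ℕ) : ℤ) • 𝟙 X := by
      have h1 : N = ∑ h : H, End.asHom (ρ h) := hN
      rw [h1, Finset.sum_congr rfl fun (h : H) _ ↦ (show End.asHom (ρ (h : G)) = 𝟙 X by rw [hρ h]; rfl),
        Finset.sum_const, Finset.card_univ, natCast_zsmul]
    have hT : LinearMap.trace ℤ_[ℓ] (X.tateModule ℓ) (tateModuleMap ℓ N) = (Fintype.card H * (2 * X.dim) : ℕ) := by
      rw [hN', tateModuleMap_zsmul, map_zsmul, trace_tateModuleMap_id_eq_two_mul_dim ℓ X hℓ, zsmul_eq_mul,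
        Int.cast_natCast, ← Nat.cast_mul]
    have h1 := trace_tateModuleMap_eq_mul_two_mul_dim ℓ (norm_comp_norm_eq_card_nsmul ρ hN) hℓ
    rw [hT, Nat.cast_inj] at h1
    have hc : 0 < Fintype.card H * 2 := Nat.mul_pos Fintype.card_pos two_pos
    have h2 : Fintype.card H * 2 * X.dim = Fintype.card H * 2 * (image N).dim := by
      rw [mul_assoc, mul_assoc]; exact h1
    exact (Nat.eq_of_mul_eq_mul_left hc h2).symm

/-- The whole-group form: `dim B_G = dim X ⟺ ρ(g) = 1 for all g` (finite `G`). [cite: LangeRodriguez2022, §3.5.2 Prop. 3.5.7 (PDF p. 69)]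
[cite: KaniRosen1989, Thm. B] -/
theorem dim_image_normG_eq_dim_iff [Fintype G] (hNG : End.of NG = ∑ g, ρ g) :
    (image NG).dim = X.dim ↔ ∀ g : G, ρ g = 1 := by
  haveI : Fintype (⊤ : Subgroup G) := Fintype.ofFinite _
  have hNG' : End.of NG = ∑ g : (⊤ : Subgroup G), ρ g := by
    rw [hNG]
    exact Fintype.sum_equiv Subgroup.topEquiv.symm.toEquiv _ _ fun _ ↦ rfl
  rw [dim_image_norm_eq_dim_iff ρ hNG']
  exact ⟨fun h g ↦ h ⟨g, Subgroup.mem_top g⟩, fun h g ↦ h g⟩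

end Dimension

/-! ## §3 (v2) The extreme cases through the invariant lattice: `(T_ℓ X)^H = T_ℓ X ⟺ dim B_H = dim X ⟺ ρ|_H = 1`,
`(T_ℓ X)^H = 0 ⟺ dim B_H = 0` -/

section Extremes

variable (ℓ : ℕ) [Fact ℓ.Prime] (ρ : G →* End X) {H : Subgroup G}

/-- **`(T_ℓ X)^H = T_ℓ X ⟺ H acts trivially on X`** (`ℓ` invertible in `K`): `T_ℓ` is faithful on `End X`
(`hom_ext_of_tateModuleMap_eq`, Milne's Lemma 12.2). [cite: Milne1986AbelianVarieties, §12 Lemma 12.2 (PDF p. 189)]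
[cite: DokchitserEtAl2022, §3 (additive functor lemma)] -/
theorem iInf_eqLocus_tateModuleMap_eq_top_iff (hℓ : (ℓ : K) ≠ 0) :
    (⨅ h : H, LinearMap.eqLocus (tateModuleMap ℓ (End.asHom (ρ h))) LinearMap.id) = ⊤ ↔ ∀ h : H, ρ h = 1 := by
  constructor
  · intro htop h
    have key : tateModuleMap ℓ (End.asHom (ρ h)) = tateModuleMap ℓ (𝟙 X) := by
      rw [tateModuleMap_id]
      refine LinearMap.ext fun x ↦ ?_
      have hx : x ∈ (⨅ h : H, LinearMap.eqLocus (tateModuleMap ℓ (End.asHom (ρ h))) LinearMap.id) := by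
        rw [htop]; exact Submodule.mem_top
      exact (mem_iInf_eqLocus_tateModuleMap_iff ℓ ρ H x).1 hx h
    exact hom_ext_of_tateModuleMap_eq ℓ hℓ key
  · intro hρ
    refine eq_top_iff.2 fun x _ ↦ (mem_iInf_eqLocus_tateModuleMap_iff ℓ ρ H x).2 fun h ↦ ?_
    rw [show End.asHom (ρ (h : G)) = 𝟙 X by rw [hρ h]; rfl, tateModuleMap_id, LinearMap.id_apply]

variable [Fintype H] {N : X ⟶ X}

/-- **`(T_ℓ X)^H = T_ℓ X ⟺ dim B_H = dim X`** (`ℓ` invertible in `K`) — both say that `H` acts trivially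
(`dim_image_norm_eq_dim_iff`, `iInf_eqLocus_tateModuleMap_eq_top_iff`). [cite: DokchitserEtAl2022, §3 (additive functor lemma)]
[cite: LangeRodriguez2022, §3.5.2 Prop. 3.5.7 (PDF p. 69)] -/
theorem iInf_eqLocus_tateModuleMap_eq_top_iff_dim_eq (hN : End.of N = ∑ h : H, ρ h) (hℓ : (ℓ : K) ≠ 0) :
    (⨅ h : H, LinearMap.eqLocus (tateModuleMap ℓ (End.asHom (ρ h))) LinearMap.id) = ⊤ ↔ (image N).dim = X.dim := by
  rw [iInf_eqLocus_tateModuleMap_eq_top_iff ℓ ρ hℓ, dim_image_norm_eq_dim_iff ρ hN]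

/-- **`(T_ℓ X)^H = 0 ⟺ B_H = 0`** (`dim B_H = 0`; `ℓ` invertible in `K`): `rk (T_ℓ X)^H = 2 dim B_H` and a torsion-free
finitely generated `ℤ_ℓ`-module of rank `0` is zero. [cite: DokchitserEtAl2022, §3 (additive functor lemma)]
[cite: LangeRodriguez2022, §2.9.1 Prop. 2.9.3 (ii) (PDF p. 46)] -/
theorem iInf_eqLocus_tateModuleMap_eq_bot_iff_dim_eq_zero (hN : End.of N = ∑ h : H, ρ h) (hℓ : (ℓ : K) ≠ 0) :
    (⨅ h : H, LinearMap.eqLocus (tateModuleMap ℓ (End.asHom (ρ h))) LinearMap.id) = ⊥ ↔ (image N).dim = 0 := by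
  haveI := X.module_free_tateModule_holds ℓ hℓ
  haveI := module_finite_tateModule_of_cast_ne_zero X ℓ hℓ
  have hrk := finrank_iInf_eqLocus_tateModuleMap_eq_two_mul_dim ℓ ρ hN hℓ
  constructor
  · intro hbot
    rw [hbot, finrank_bot] at hrk
    omega
  · intro h0
    rw [h0, mul_zero] at hrk
    set V := ⨅ h : H, LinearMap.eqLocus (tateModuleMap ℓ (End.asHom (ρ h))) LinearMap.id
    have hsub : Subsingleton ↥V := (Module.finrank_zero_iff (R := ℤ_[ℓ]) (M := ↥V)).1 hrk
    exact (Submodule.eq_bot_iff V).2 fun x hx ↦ congrArg Subtype.val (Subsingleton.elim (⟨x, hx⟩ : ↥V) 0)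

end Extremes

end AbelianVariety

end Literature.AlgebraicGeometry.Motives
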